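import Mathlib
import HarnessLib
import HarnessLib.Audit
import Summits.CriticalPhenomena.Statement
import Literature.Probability.RandomPlanarGeometry.HexParafermion
import Literature.Probability.RandomPlanarGeometry.HexSAW
import Literature.Probability.RandomPlanarGeometry.SLEConvergenceCriterion
import Literature.Probability.RandomPlanarGeometry.ConformalMap
import HarnessLib.Audit.Status.Attr

/-!
Route: SAWQuarterTwist

DORMANT since 2026-08-26T10:52:25Z (reconciler: no traction for 8.3 d (last activity item-evidence-added at 2026-08-18T02:01:51Z); parked, not closed — `ledger route dormant route-CriticalPhenomena-SAWQuarterTwist --off` to reactivate) — unstaffed, not closed; items shared with open routes are served there. `ledger route dormant <id> --off` reactivates.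

# Route SAWQuarterTwist — a quarter flux at the source makes the bulk SAW parafermion pair exact;
identify the chiral propagator first, fuse to the boundary

It suffices to show X = (P) ∧ (B) ∧ (F) — a BULK-FIRST form of the Duminil-Copin–Smirnov programme
made possible by a new exact
lattice fact (support QuarterTwistRelation): the hexagonal SAW parafermion with an INTERIOR source
mid-edge a, twisted by i^N (N = algebraic
crossing number of the walk with a ray from the hexagon adjacent to a), satisfies the DCS vertex
relation exactly at every vertex off the ray
(untwisted it fails by the source-encircling loops; the admissible fluxes are exactly u with u² = −1
at the source and u² = 1 at any other
hexagon). (P) TwistedPropagatorLaw: the whole-plane quarter-twisted two-point observable has a pure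
power profile C|w|^(−α)e^(−iαθ);
(B) BulkScalingLimitExists: in Dobrushin domains the pinned interior-source twisted observable has a
nondegenerate scaling limit against bulk
test functions; (F) BulkToBoundary: (P), (B) ⇒ DCS Conjecture 2 in the repaired form
HexObservableLimitR (the boundary-source observable is
the a ∈ ∂Ω member of the same exact family, where N ≡ 0). Then the shared pipeline ObservableToSLER
+ HexTight gives Conjecture 1 on the
hexagonal lattice and HexTransfer carries it to δℤ².
Lean: `TwistedPropagatorLaw ∧ BulkScalingLimitExists ∧ BulkToBoundary`

## Assembly
Pure logic: BulkToBoundary turns TwistedPropagatorLaw and BulkScalingLimitExists into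
HexObservableLimitR; ObservableToSLER with HexTight
gives Conjecture 1 on the hexagonal lattice written out; HexTransfer gives the δℤ² Statement: `hTr
(hO (h3 h1 h2) hT)` (glue.lean, checked: closes OK, codes []). The Assembly item below is the
non-glue frame (deps BulkToBoundary, ObservableToSLER).

Rationale: WHY THIS LINE. The lever is a gauge covariance of the DCS observable found and verified in this unit
(exact enumeration, residual ≤ 4·10⁻¹³ on domains up to
55 vertices, folder exp/): with fluxes Φ(f) ∈ U(1) on hexagons realised by any connection, the
twisted observable Σ_γ x_c^ℓ e^(−i5W/8) hol(γ)
obeys the transported vertex relation at all v ∉ a iff Φ(f)² = 1 off the source and Π_(f adj a)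
Φ(f)² = −1 at an interior source — proof
sketch: in DCS's grouping the triples are local and a pair differs by traversing its loop C in
opposite directions, so hol(γ₁)/hol(γ₂) = hol(C)²
while the turning bookkeeping is off by 8π exactly when a lies inside C. Consequences: (i) ℤ₂ fluxes
are free — they are the lattice twist
fields of Gamsa–Cardy/Simmons–Cardy (φ_(2,1), weight (3κ−8)/16 = 0 at κ = 8/3; SimmonsCardy2008 §2,
§3), whose boundary values are Schramm
passage characters, and two adjacent fluxes fuse to walks through the common edge (φ_(2,1)×φ_(2,1) =
1 + φ_(3,1), the 2-leg operator);
(ii) an interior source needs a QUARTER flux, which turns the non-chiral one-leg source into the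
chiral partner ψ† — the twisted two-point
function is the lattice ⟨ψ†(a)ψ(z)⟩, exactly Morera-closed in z, with predicted profile (z−a)^(−5/4)
whose monodromy e^(−2πi·5/4) = −i is the
quarter flux (for Ising, σ = 1/2, the condition reads u² = +1: Hongler–Smirnov's full-plane fermion
needs no twist, HonglerSmirnov2013). What it
buys against the boundary-source programme (DuminilCopinSmirnov2012 Conj. 2; routes
SAWAsymptoticMorera, SAWDefectDecoherence, SAWDevelopingMap,
SAWResidueField, SAWWindingAlias, SAWPhaseRetrieval): the singularity sits in the bulk with a
universal lattice neighbourhood (no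
root-on-a-rough-boundary normalisation, cf. the corridor refutation of stmt-5420 and
KennedyLawler2013), whole-plane objects with full lattice
symmetry exist, and the exponent is quantised by topology (any power profile has 4α ∈ ℤ). Imported
areas: lattice gauge fields / disorder
operators (Kadanoff–Ceva, Chelkak–Hongler–Izyurov spinors, ChelkakHonglerIzyurov2015) transplanted
from Ising to n = 0; c = 0 twist-field CFT
(SimmonsCardy2008); the Kemppainen–Smirnov martingale pipeline is reused verbatim
(KemppainenSmirnov2017).

RANKED CRUXES. #0 HexObservableLimitR (target) — the route's intermediate target —
Duminil-Copin–Smirnov 2012 Conjecture 2 in the repaired flat-pinned test-function form (shared item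
stmt-CriticalPhenomena-14003, verbatim from SAWDefectDecoherence): the conclusion of BulkToBoundary
and the antecedent of ObservableToSLER; X = TwistedPropagatorLaw ∧ BulkScalingLimitExists ∧
BulkToBoundary implies it by modus ponens. (why it might fail: Conj. 2 open since 2010; the
F(b_δ)-normalisation is universal only for the pinned flat class; a refuter already killed the
unpinned form (stmt-5420) with a corridor witness.) [DuminilCopinSmirnov2012, KennedyLawler2013,
Summit.CriticalPhenomena.SAWScalingLimit.Theorems.SAWDefectDecoherenceHexObservableLimit_refuted]
#2 TwistedPropagatorLaw (crux) — whole-plane quarter-twisted propagator law: there are α > 0 and C ≠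
0 such that for hexagonal domains Λ_s exhausting the plane around the source hexagon (cell x_s,
source = its left vertical side, cut = the horizontal ray to the right), s^(α−2) Σ_e ψ((mid e −
centre)/s) F^tw_s(e) → C ∫ ψ(w)|w|^(−α) e^(−iα θ(w)) dw for every ψ ∈ C_c(ℂ∖0), θ(w) = arg(−w)+π ∈
(0, 2π] the angle from the cut. [difficulty: open-problem] (why it might fail: c = 0 is logarithmic:
the chiral pair ⟨ψ†ψ⟩ may carry (log|w|)^k factors or two competing sectors (u = i vs −i classes
3/4+ℤ and 1/4+ℤ), and the mid-edge orientation classes may need separate amplitudes — then no single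
pure power profile exists.) [DuminilCopinSmirnov2012, SimmonsCardy2008, HonglerSmirnov2013,
arXiv:1203.2959]
#3 BulkScalingLimitExists (crux) — for every Dobrushin domain D, interior point p, admissible
hexagonal discretisations Λ_δ (simply connected, connected, inside Ω, exact lattice in a ball around
p, exhausting compacts) and source cells x_δ with δ·x_δ → p, there are ψ-independent normalisers n_δ
and a nonzero limit functional ℓ with n_δ δ² Σ_e ψ(δ mid e) F^tw_δ(e) → ℓ(ψ) for every bulk test
function ψ ∈ C_c(Ω∖p). [difficulty: open-problem] (why it might fail: this is the a-priori
regularity/precompactness half of the half-CR barrier, now for a bulk-sourced current: without a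
Harnack-type bound for Morera-closed SAW currents the normalised field may fail to converge
(lattice-scale curl noise, or collar-dependent limits along δ).) [DuminilCopinSmirnov2012,
Smirnov2007ICM, KemppainenSmirnov2017,
Literature.Barriers.CriticalPhenomena.ParafermionicHalfCauchyRiemann]
#4 BulkToBoundary (crux) — bulk-to-boundary fusion: the propagator law and the bulk scaling limit
imply DCS Conjecture 2 in the repaired, flat-pinned, test-function form HexObservableLimitR — move
the source to the boundary (there N ≡ 0 and the twisted family IS the DCS observable; h_ψ = h_(1,2)
= 5/8 so the fusion is regular) and identify the boundary limit by uniqueness of the σ = 5/8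
Riemann–Hilbert problem in the limit class. [deps: TwistedPropagatorLaw, BulkScalingLimitExists]
[difficulty: XL] (why it might fail: continuity of the normalised family in the SOURCE variable up
to ∂Ω has no lattice equation behind it (the source-variable relations are only conjugates of target
ones); a boundary layer of width O(1) at the root could renormalise the limit by a root-geometry
factor.) [DuminilCopinSmirnov2012, KennedyLawler2013, ChelkakHonglerIzyurov2015,
Summit.CriticalPhenomena.SAWScalingLimit.Theorems.SAWDefectDecoherenceHexObservableLimit_refuted]
#5 HexTight (crux) — eventual tightness of the critical hexagonal SAW laws (shared item
stmt-CriticalPhenomena-5423, verbatim): for every Dobrushin domain and hexagonal endpoint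
approximation the family δ ↦ hexSAWLaw pushed to CurveClass ℂ is tight along 𝓝[>]0. [difficulty:
open-problem] (why it might fail: no RSW/annulus-crossing technology for SAW (n = 0: no FKG);
strongest inputs are sub-ballisticity and B_T ≤ 100 T^(−10⁻¹⁰) (arXiv:2310.17299); the eventual form
avoids the refuted all-δ item 0772.) [KemppainenSmirnov2017, DuminilCopinHammond2013,
arXiv:2310.17299]
#6 ObservableToSLER (crux) — the martingale-observable identification (shared item
stmt-CriticalPhenomena-14005, verbatim): HexObservableLimitR → HexTight → Duminil-Copin–Smirnov
Conjecture 1 on the hexagonal lattice written out (convergence of hexSAWLaw to chordal SLE(8/3) for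
every Dobrushin domain and hexagonal endpoint approximation). [deps: BulkToBoundary, HexTight]
[difficulty: XL] (why it might fail: the martingale needs the observable limit in the SAW's own slit
domains (rough tip), Carathéodory-uniformly, while HexObservableLimitR is per fixed flat-pinned
Jordan domain; the b-normalisation is load-bearing for the drift.) [KemppainenSmirnov2017,
DuminilCopinSmirnov2012, LawlerSchrammWerner2004SAW]
#7 HexTransfer (crux) — lattice-universality transfer (shared item stmt-CriticalPhenomena-14221,
verbatim): Conjecture 1 on the hexagonal lattice implies the δℤ² statement SAWScalingLimit. [deps:
ObservableToSLER] [difficulty: open-problem] (why it might fail: the uniform ℤ² SAW lies in no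
Yang–Baxter family (barrier NienhuisWeightsExcludeVertexSAW), so no transfer tool exists even given
the hexagonal limit; Kennedy–Lawler boundary effects could split ℤ² endpoint classes.)
[GlazmanManolescu2019, KennedyLawler2013,
Literature.Barriers.CriticalPhenomena.NienhuisWeightsExcludeVertexSAW]
#9 QuarterTwistRelation (support) — the quarter-twist vertex relation (exact, finite, NEW): on every
simply connected hexagonal domain Λ and every cell x₀, the observable Σ_γ x_c^ℓ e^(−i(5/8)W(γ))
i^(N(γ)) with source the left vertical side of the hexagon at x₀ and N the signed number of
traversals of the vertical edges crossed by the horizontal ray from triEmbed x₀ to the right (up =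
+1) satisfies (p−v)F(p)+(q−v)F(q)+(r−v)F(r) = 0 at every v ∈ Λ that is not an endpoint of the source
edge or of a cut edge. Proof = DCS grouping + loop-orientation bookkeeping (pairs: hol ratio =
hol(C)², turning off by 8π iff x₀ inside C); verified by enumeration (folder exp/canonical.py,
spinor.py, gauge.py). [difficulty: M] [DuminilCopinSmirnov2012,
Literature.Probability.RandomPlanarGeometry.SAW.DuminilCopinSmirnov2012_lemma1]

TWO-LAYER PLAN. BulkScalingLimitExists ⇐ BulkHarnack (interior Hölder/Harnack for self-normalised
Morera-closed twisted currents, averaged over sources on a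
periodic sublattice) → CurlNoiseDecay (face-residue density → 0 weakly) → BulkScalingLimitExists.
BulkToBoundary ⇐ MonodromyQuantisation
(TwistedPropagatorLaw ⇒ 4α ∈ ℤ, provable now) → SourceToBoundaryContinuity → RHUniqueness →
BulkToBoundary. TwistedPropagatorLaw ⇐ a
transfer-matrix certificate of the profile on cylinders (kit) → whole-plane existence.

KILL CRITERIA. A counterexample to QuarterTwistRelation (one vertex of one domain) kills the lever
and the route (close refuted:QuarterTwistRelation). A
refutation of TwistedPropagatorLaw by certified cylinder numerics showing log factors or two sectors
is refuted-misstated: restate the profile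
(log^k, or per flux sign u = ±i) and re-certify the glue. HexObservableLimitR refuted again
(substantively) moots BulkToBoundary — pivot to
the passage-character form (fluxes −1, boundary values = Schramm correlators) feeding
SAWSchrammPassage's SchrammPassageUniform instead.
HexTight or HexTransfer refuted sinks this route together with its five siblings.

NOT DECOMPOSED YET. The ℤ₂ (flux −1) companion identity with boundary source (also exact; the
lattice twist field) and the sector form Σ_N (±i)^N d_N(v) = 0 are
left as prover-level lemmas riding with QuarterTwistRelation; the orientation-class bookkeeping of
mid-edges inside the averaged statements;
the Riemann–Hilbert index computation on the 4-fold cover; any use of interior sources in multiply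
connected domains (flux through holes).

CHEAPEST FALSIFIER. QuarterTwistRelation itself: exact enumeration on a 40–60-vertex hexagonal
domain with a deep interior source — RUN in this unit
(exp/canonical.py: residual ≤ 4.4·10⁻¹³ at all 55 non-excluded vertices; u = 1, −1, e^(iπ/4)… fail
at 10⁻³; exp/gauge.py for arbitrary ℤ₂
fluxes). Next cheapest: a kit transfer-matrix computation of the twisted propagator on width-L
cylinders (L ≤ 14) testing the pure power
profile and reading α (predicted 5/4 in one of the two flux signs).

NUMBERS. σ = 5/8, x_c = 1/√(2+√2); admissible source flux u² = −1 (verified), other hexagons u² = 1;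
predicted α = 2σ = 5/4 with e^(2πiα) ∈ {u, ū};
h_(2,1)(8/3) = 0 (twist field), h_(3,1) = 1/3 (2-leg), Schramm at κ = 8/3: P = cos²(θ/2). Items at
open: 9 (1 target, 6 cruxes, 1 support, 1 assembly).

DEFINITION REQUESTS. None blocking: the twisted observable is written inline over HexMidEdgeSAW /
weight / hexCriticalFugacity. A named `hexTwistedObservable Λ x₀ u z`
(topic Summits/CriticalPhenomena/SAWScalingLimit/Theorems) would shorten the three statements; to be
filed after open.

Novelty: Searches (2026-08-16): arXiv 'pivot algorithm self-avoiding walk' (17), 'Kennedy self-avoiding walk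
scaling limit' (10), 'discretely holomorphic
parafermions' (6: Rajabpour–Cardy, Ikhlef–Cardy, Ikhlef 2012 integrable boundaries, Ikhlef–Rajabpour
AT, 8-vertex, Rigas 2023), 'Off-critical
parafermions winding' (1: arXiv:1203.2959, boundary wedges only), 'surface adsorption self-avoiding
walks honeycomb' (3), 'isomorphism theorems
supersymmetric sigma model' (BHS 1904.01532 read); lit galaxy search 'parafermionic observable
monodromy' --star all (0); galaxy bm25 (pdf)
'parafermionic observable with interior source … monodromy, spinor, disorder operator' (15: Smirnov
ICM, DC Ensaios notes read §9.3 — Ising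
spinor on a double cover branched away from the source; nothing at n = 0); in-tree grep of
HexParafermion*, HexSAW*, Theses/* for
monodromy/branch/spinor/interior source (0); ledger idea list (~130 cards: none with interior
sources, twist fields or gauge data); lit searchd
local index down all session (logged), OpenAlex/S2 429.
Nearest prior art found: DuminilCopinSmirnov2012 Lemma 1 (boundary source);
ChelkakHonglerIzyurov2015 / DC Ensaios Def. 9.31 (Ising ℤ₂ spinor
observables, σ = 1/2 where no source flux is needed); SimmonsCardy2008 (continuum twist operators
φ_(2,1) at n = 0, Schramm generalisations);
HonglerSmirnov2013 (full-plane Ising fermion); in-tree card twisted-self-energy-half-cr (lace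
expansion of the UNtwisted whole-plane propagator —
by the present finding not a  [refs: 1203.2959, DuminilCopinSmirnov2012, ChelkakHonglerIzyurov2015, SimmonsCardy2008, HonglerSmirnov2013]

Barriers (technique_class: parafermion, twist-gauge, spinor-observable): - technique_class: parafermion, twist-gauge, spinor-observable
- Literature.Barriers.CriticalPhenomena.ParafermionicHalfCauchyRiemann: conceded that gauging adds
no equations per source (kernel dimension = number of hexagons is rank-nullity; a flux −1 only
delocalises the local hexagon mode); evaded in WHERE the missing a-priori input is needed — at a
bulk singularity with universal lattice neighbourhood and exact monodromy (4α ∈ ℤ), not at a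
boundary root — and the regularity half is filed openly as BulkScalingLimitExists.
- Literature.Barriers.CriticalPhenomena.NienhuisWeightsExcludeVertexSAW: respected — everything is
hexagonal; δℤ² only through HexTransfer.
- Literature.Barriers.CriticalPhenomena.SAWNoUnitaryCFT: no positivity or unitarity is used; the
twist fields are the known c = 0 LCFT objects (SimmonsCardy2008).
- Literature.Barriers.CriticalPhenomena.SmirnovTriangularOnly / EmbeddingModulusUniqueness: not
engaged (no three-fold symmetry, no embedding-blind claim; conformal structure enters through the
limit of an exact lattice current).
- Negatives index: stmt-5420 (HexObservableLimit) avoided by using the repaired HexObservableLimitR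
verbatim (flat-pinned roots); stmt-0772 (all-δ tightness) avoided by the eventual IsTightAlongMesh
form of HexTight; stmt-8312 (phase retrieval stability) unrelated — no modulus retrieval here.

History (route lifecycle, newest last):
- 2026-08-26T10:52:25Z · DORMANT — reconciler: no traction for 8.3 d (last activity item-evidence-added at 2026-08-18T02:01:51Z); parked, not closed — `ledger route dormant route-CriticalPhenomen (operator:999:2442365)

sub-problem: SAWScalingLimit · status: dormant · opened planner-plan-novel-CriticalPhenomena-SAWScaling-8a38611a-v2-g7-0 2026-08-16T20:27:52Z · rev 2 · ledger route-CriticalPhenomena-SAWQuarterTwist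
GENERATED by the gate from the ledger (D-0016/17). Provers cite these decls: `theorem foo : Summit.CriticalPhenomena.SAWScalingLimit.Theses.SAWQuarterTwist.<Decl> := …` in Summits/CriticalPhenomena/SAWScalingLimit/Theorems/<Name>.lean.
-/

namespace Summit.CriticalPhenomena.SAWScalingLimit.Theses.SAWQuarterTwist

open scoped BigOperators Topology Manifold Classical MeasureTheory ProbabilityTheory Matrix InnerProductSpace ComplexConjugate ContinuousMap
open Filter Set Function TopologicalSpace MeasureTheory

attribute [summit_statement] _root_.SAWScalingLimit

/-- item stmt-CriticalPhenomena-14003 · target · rank 0 · open · by planner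
why it might fail: Conj. 2 open since 2010; the F(b_δ)-normalisation is universal only for the pinned flat class; a refuter already killed the unpinned form (stmt-5420) with a corridor witness.
sources: DuminilCopinSmirnov2012, KennedyLawler2013, Summit.CriticalPhenomena.SAWScalingLimit.Theorems.SAWDefectDecoherenceHexObservableLimit_refuted
[target] repaired HexObservableLimit (stmt-CriticalPhenomena-5420, refuted-misstated by
Summit.CriticalPhenomena.SAWScalingLimit.Theorems.SAWDefectDecoherenceHexObservableLimit_refuted —
the corridor witness: with Λ_δ free in the o(1)-collar at ∂Ω a boundary-hugging width-1 corridor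
with a moat relocates the conformally effective root (3/4 → 1/2 on the half-disc) while every old
hypothesis holds, so the universal c ≠ 0 forces z(p−q)(1−pq) = 0). DCS 2012 Conjecture 2 (hexagonal
lattice), averaged against bulk test functions ψ ∈ C_c(Ω) and normalised at one boundary mid-edge
b_δ, with the ROOT PINNED CONFORMALLY exactly as b already was: for BOTH marked points p_i (i = 0
the root a, i = 1 the normalisation point b) the domain is the horizontal half-plane piece {im z >
im p_i} inside the ball B(p_i, ρ) and the discretisation is the exact half-lattice there (v ∈ Λ_δ ↔
row(v) ≥ m_i(δ)); otherwise as before — ∃ c ≠ 0 universal with δ²⟨ψ, F_δ⟩/F_δ(b_δ) → c ∫ ψ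
exp((5/8)(L − L_b)) for every such Dobrushin domain, every admissible discretisation family (simply
connected, connected, inside Ω, exhausting compacts), boundary mid-edges a_δ → a, b_δ → b, φ: a ↦ ∞,
b ↦ 0, L = log φ' continuous wi -/
@[route_item "route-CriticalPhenomena-SAWQuarterTwist"]
def HexObservableLimitR : Prop :=
  ∃ c : ℂ, c ≠ 0 ∧ ∀ (D : Literature.Probability.RandomPlanarGeometry.DobrushinDomain) (ρ : ℝ) (Λ : ℝ → Finset Literature.Probability.LatticeModels.HexVertex) (m : Fin 2 → ℝ → ℤ) (a b : ℝ → Sym2 Literature.Probability.LatticeModels.HexVertex) (Φ : Literature.Probability.RandomPlanarGeometry.ConformalEquiv D.carrier UpperHalfPlane.upperHalfPlaneSet) (L : ℂ → ℂ) (Lb : ℂ) (ψ : ℂ → ℂ), let F : ℝ → Sym2 Literature.Probability.LatticeModels.HexVertex → ℂ := fun δ z => Literature.Probability.RandomPlanarGeometry.SAW.hexParafermionicObservable (Λ δ) (a δ) Literature.Probability.RandomPlanarGeometry.SAW.hexCriticalFugacity (5 / 8) z; 0 < ρ → (∀ i : Fin 2, D.carrier ∩ Metric.ball (D.pt i) ρ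 = {z : ℂ | (D.pt i).im < z.im} ∩ Metric.ball (D.pt i) ρ) → (∀ᶠ δ : ℝ in nhdsWithin 0 (Set.Ioi 0), Literature.Probability.RandomPlanarGeometry.SAW.hexDomainSimplyConnected (Λ δ) ∧ a δ ∈ Literature.Probability.RandomPlanarGeometry.SAW.hexDomainBoundary (Λ δ) ∧ b δ ∈ Literature.Probability.RandomPlanarGeometry.SAW.hexDomainBoundary (Λ δ) ∧ Nonempty (Literature.Probability.RandomPlanarGeometry.SAW.HexMidEdgeSAW (Λ δ) (a δ) (b δ)) ∧ (Literature.Probability.LatticeModels.hexGraph.induce ((Λ δ : Finset Literature.Probability.LatticeModels.HexVertex) : Set Literature.Probability.LatticeModels.HexVertex)).Preconnected ∧ (∀ v ∈ Λ δ, (δ : ℂ) * Literature.Probability.LatticeModels.hexCenter v ∈ D.carrier) ∧ (∀ i : Fin 2, ∀ v : Literature.Probability.LatticeModels.HexVertex, (δ : ℂ) * Literature.Probability.LatticeModels.hexCenter v ∈ Metric.ball (D.pt i) ρ → (v ∈ Λ δ ↔ m i δ ≤ v.1 1))) → (∀ K : Set ℂ, IsCompact K → K ⊆ D.carrier → ∀ᶠ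 δ : ℝ in nhdsWithin 0 (Set.Ioi 0), ∀ v : Literature.Probability.LatticeModels.HexVertex, (δ : ℂ) * Literature.Probability.LatticeModels.hexCenter v ∈ K → v ∈ Λ δ) → Filter.Tendsto (fun δ : ℝ => (δ : ℂ) * Literature.Probability.RandomPlanarGeometry.SAW.hexMidpoint (a δ)) (nhdsWithin 0 (Set.Ioi 0)) (nhds (D.pt 0)) → Filter.Tendsto (fun δ : ℝ => (δ : ℂ) * Literature.Probability.RandomPlanarGeometry.SAW.hexMidpoint (b δ)) (nhdsWithin 0 (Set.Ioi 0)) (nhds (D.pt 1)) → Filter.Tendsto (fun x => ‖Φ x‖) (nhdsWithin (D.pt 0) D.carrier) Filter.atTop → Φ.HasBoundaryValue (D.pt 1) 0 → ContinuousOn L D.carrier → (∀ z ∈ D.carrier, Complex.exp (L z) = deriv Φ z) → Filter.Tendsto L (nhdsWithin (D.pt 1) D.carrier) (nhds Lb) → Continuous ψ → HasCompactSupport ψ → tsupport ψ ⊆ D.carrier → Filter.Tendsto (fun δ : ℝ => (δ : ℂ) ^ 2 * (∑ᶠ e ∈ Literature.Probability.RandomPlanarGeometry.SAW.hexDomainMidEdges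 (Λ δ), ψ ((δ : ℂ) * Literature.Probability.RandomPlanarGeometry.SAW.hexMidpoint e) * F δ e) / F δ (b δ)) (nhdsWithin 0 (Set.Ioi 0)) (nhds (c * ∫ z, ψ z * Complex.exp ((5 / 8 : ℂ) * (L z - Lb))))

/-- item stmt-CriticalPhenomena-16650 · crux · rank 2 · open · by planner
why it might fail: c = 0 is logarithmic: the chiral pair ⟨ψ†ψ⟩ may carry (log|w|)^k factors or two competing sectors (u = i vs −i classes 3/4+ℤ and 1/4+ℤ), and the mid-edge orientation classes may need separate amplitudes — then no single pure power profile exists.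
sources: DuminilCopinSmirnov2012, SimmonsCardy2008, HonglerSmirnov2013, arXiv:1203.2959
[crux] whole-plane quarter-twisted propagator law: there are α > 0 and C ≠ 0 such that for hexagonal
domains Λ_s exhausting the plane around the source hexagon (cell x_s, source = its left vertical
side, cut = the horizontal ray to the right), s^(α−2) Σ_e ψ((mid e − centre)/s) F^tw_s(e) → C ∫
ψ(w)|w|^(−α) e^(−iα θ(w)) dw for every ψ ∈ C_c(ℂ∖0), θ(w) = arg(−w)+π ∈ (0, 2π] the angle from the
cut. [difficulty: open-problem] -/
@[route_item "route-CriticalPhenomena-SAWQuarterTwist", crux]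
def TwistedPropagatorLaw : Prop :=
  ∃ (α : ℝ) (C : ℂ), 0 < α ∧ C ≠ 0 ∧ ∀ (Λ : ℝ → Finset Literature.Probability.LatticeModels.HexVertex) (x : ℝ → Literature.Probability.LatticeModels.Site 2) (ψ : ℂ → ℂ), let sgn : ℝ → Literature.Probability.LatticeModels.HexVertex → Literature.Probability.LatticeModels.HexVertex → ℤ := fun s p q => if q.2 = 0 ∧ p.2 = 1 ∧ p.1 = q.1 - Pi.single 1 1 ∧ q.1 1 = x s 1 ∧ x s 0 ≤ q.1 0 then 1 else if p.2 = 0 ∧ q.2 = 1 ∧ q.1 = p.1 - Pi.single 1 1 ∧ p.1 1 = x s 1 ∧ x s 0 ≤ p.1 0 then -1 else 0; let a : ℝ → Sym2 Literature.Probability.LatticeModels.HexVertex := fun s => s((x s - Pi.single 0 1, (0 : Fin 2)), (x s - Pi.single 0 1 - Pi.single 1 1, (1 : Fin 2))); let F : ℝ → Sym2 Literature.Probability.LatticeModels.HexVertex → ℂ := fun s z => ∑ γ : Literature.Probability.RandomPlanarGeometry.SAW.HexMidEdgeSAW (Λ s) (a s) z, γ.weight Literature.Probability.RandomPlanarGeometry.SAW.hexCriticalFugacity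 (5 / 8) * Complex.I ^ ((γ.verts.zip γ.verts.tail).map (fun pq => sgn s pq.1 pq.2)).sum; (∀ s, Literature.Probability.RandomPlanarGeometry.SAW.hexDomainSimplyConnected (Λ s)) → (∀ K : Set ℂ, IsCompact K → ∀ᶠ s : ℝ in Filter.atTop, ∀ v : Literature.Probability.LatticeModels.HexVertex, (Literature.Probability.LatticeModels.hexCenter v - Literature.Probability.LatticeModels.triEmbed (x s)) / (s : ℂ) ∈ K → v ∈ Λ s) → Continuous ψ → HasCompactSupport ψ → tsupport ψ ⊆ {(0 : ℂ)}ᶜ → Filter.Tendsto (fun s : ℝ => (s : ℂ) ^ ((α : ℂ) - 2) * ∑ᶠ e ∈ Literature.Probability.RandomPlanarGeometry.SAW.hexDomainMidEdges (Λ s), ψ ((Literature.Probability.RandomPlanarGeometry.SAW.hexMidpoint e - Literature.Probability.LatticeModels.triEmbed (x s)) / (s : ℂ)) * F s e) Filter.atTop (nhds (C * ∫ w, ψ w * ((‖w‖ ^ (-α) : ℝ) : ℂ) * Complex.exp (-(Complex.I * (α : ℂ) * ((Complex.arg (-w) + Real.pi : ℝ) : ℂ)))))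

/-- item stmt-CriticalPhenomena-16651 · crux · rank 3 · open · by planner
why it might fail: this is the a-priori regularity/precompactness half of the half-CR barrier, now for a bulk-sourced current: without a Harnack-type bound for Morera-closed SAW currents the normalised field may fail to converge (lattice-scale curl noise, or collar-dependent limits along δ).
sources: DuminilCopinSmirnov2012, Smirnov2007ICM, KemppainenSmirnov2017, Literature.Barriers.CriticalPhenomena.ParafermionicHalfCauchyRiemann
[crux] for every Dobrushin domain D, interior point p, admissible hexagonal discretisations Λ_δ
(simply connected, connected, inside Ω, exact lattice in a ball around p, exhausting compacts) and
source cells x_δ with δ·x_δ → p, there are ψ-independent normalisers n_δ and a nonzero limit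
functional ℓ with n_δ δ² Σ_e ψ(δ mid e) F^tw_δ(e) → ℓ(ψ) for every bulk test function ψ ∈ C_c(Ω∖p).
[difficulty: open-problem] -/
@[route_item "route-CriticalPhenomena-SAWQuarterTwist", crux]
def BulkScalingLimitExists : Prop :=
  ∀ (D : Literature.Probability.RandomPlanarGeometry.DobrushinDomain) (p : ℂ) (ρ : ℝ) (Λ : ℝ → Finset Literature.Probability.LatticeModels.HexVertex) (x : ℝ → Literature.Probability.LatticeModels.Site 2), let sgn : ℝ → Literature.Probability.LatticeModels.HexVertex → Literature.Probability.LatticeModels.HexVertex → ℤ := fun s p q => if q.2 = 0 ∧ p.2 = 1 ∧ p.1 = q.1 - Pi.single 1 1 ∧ q.1 1 = x s 1 ∧ x s 0 ≤ q.1 0 then 1 else if p.2 = 0 ∧ q.2 = 1 ∧ q.1 = p.1 - Pi.single 1 1 ∧ p.1 1 = x s 1 ∧ x s 0 ≤ p.1 0 then -1 else 0; let a : ℝ → Sym2 Literature.Probability.LatticeModels.HexVertex := fun s => s((x s - Pi.single 0 1, (0 : Fin 2)), (x s - Pi.single 0 1 - Pi.single 1 1, (1 : Fin 2))); let F : ℝ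 → Sym2 Literature.Probability.LatticeModels.HexVertex → ℂ := fun s z => ∑ γ : Literature.Probability.RandomPlanarGeometry.SAW.HexMidEdgeSAW (Λ s) (a s) z, γ.weight Literature.Probability.RandomPlanarGeometry.SAW.hexCriticalFugacity (5 / 8) * Complex.I ^ ((γ.verts.zip γ.verts.tail).map (fun pq => sgn s pq.1 pq.2)).sum; p ∈ D.carrier → 0 < ρ → Metric.ball p ρ ⊆ D.carrier → (∀ᶠ δ : ℝ in nhdsWithin 0 (Set.Ioi 0), Literature.Probability.RandomPlanarGeometry.SAW.hexDomainSimplyConnected (Λ δ) ∧ (Literature.Probability.LatticeModels.hexGraph.induce ((Λ δ : Finset Literature.Probability.LatticeModels.HexVertex) : Set Literature.Probability.LatticeModels.HexVertex)).Preconnected ∧ (∀ v ∈ Λ δ, (δ : ℂ) * Literature.Probability.LatticeModels.hexCenter v ∈ D.carrier) ∧ (∀ v : Literature.Probability.LatticeModels.HexVertex, (δ : ℂ) * Literature.Probability.LatticeModels.hexCenter v ∈ Metric.ball p ρ → v ∈ Λ δ)) → (∀ K : Set ℂ, IsCompact K → K ⊆ D.carrier → ∀ᶠ δ : ℝ in nhdsWithin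 0 (Set.Ioi 0), ∀ v : Literature.Probability.LatticeModels.HexVertex, (δ : ℂ) * Literature.Probability.LatticeModels.hexCenter v ∈ K → v ∈ Λ δ) → Filter.Tendsto (fun δ : ℝ => (δ : ℂ) * Literature.Probability.LatticeModels.triEmbed (x δ)) (nhdsWithin 0 (Set.Ioi 0)) (nhds p) → ∃ (n : ℝ → ℂ) (ℓ : (ℂ → ℂ) → ℂ), (∃ ψ₀ : ℂ → ℂ, Continuous ψ₀ ∧ HasCompactSupport ψ₀ ∧ tsupport ψ₀ ⊆ D.carrier \ {p} ∧ ℓ ψ₀ ≠ 0) ∧ ∀ ψ : ℂ → ℂ, Continuous ψ → HasCompactSupport ψ → tsupport ψ ⊆ D.carrier \ {p} → Filter.Tendsto (fun δ : ℝ => n δ * (δ : ℂ) ^ 2 * ∑ᶠ e ∈ Literature.Probability.RandomPlanarGeometry.SAW.hexDomainMidEdges (Λ δ), ψ ((δ : ℂ) * Literature.Probability.RandomPlanarGeometry.SAW.hexMidpoint e) * F δ e) (nhdsWithin 0 (Set.Ioi 0)) (nhds (ℓ ψ))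

/-- item stmt-CriticalPhenomena-16652 · crux · rank 4 · open · by planner
why it might fail: continuity of the normalised family in the SOURCE variable up to ∂Ω has no lattice equation behind it (the source-variable relations are only conjugates of target ones); a boundary layer of width O(1) at the root could renormalise the limit by a root-geometry factor.
sources: DuminilCopinSmirnov2012, KennedyLawler2013, ChelkakHonglerIzyurov2015, Summit.CriticalPhenomena.SAWScalingLimit.Theorems.SAWDefectDecoherenceHexObservableLimit_refuted
[crux] bulk-to-boundary fusion: the propagator law and the bulk scaling limit imply DCS Conjecture 2
in the repaired, flat-pinned, test-function form HexObservableLimitR — move the source to the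
boundary (there N ≡ 0 and the twisted family IS the DCS observable; h_ψ = h_(1,2) = 5/8 so the
fusion is regular) and identify the boundary limit by uniqueness of the σ = 5/8 Riemann–Hilbert
problem in the limit class. [deps: TwistedPropagatorLaw, BulkScalingLimitExists] [difficulty: XL] -/
@[route_item "route-CriticalPhenomena-SAWQuarterTwist", crux]
def BulkToBoundary : Prop :=
  TwistedPropagatorLaw → BulkScalingLimitExists → HexObservableLimitR

/-- item stmt-CriticalPhenomena-5423 · crux · rank 5 · open · by planner
why it might fail: no RSW/annulus-crossing technology for SAW (n = 0: no FKG); strongest inputs are sub-ballisticity and B_T ≤ 100 T^(−10⁻¹⁰) (arXiv:2310.17299); the eventual form avoids the refuted all-δ item 0772.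
sources: KemppainenSmirnov2017, DuminilCopinHammond2013, arXiv:2310.17299
[crux] eventual tightness of the critical hexagonal SAW laws: for every Dobrushin domain and
hexagonal endpoint approximation (IsEmbEndpointApprox hexGraph hexCenter), the family δ ↦ hexSAWLaw
pushed to CurveClass ℂ is tight along 𝓝[>]0 (IsTightAlongMesh — NOT the refuted all-δ IsTightLaws
form of stmt-CriticalPhenomena-0772). [difficulty: open-problem] -/
@[route_item "route-CriticalPhenomena-SAWQuarterTwist", crux]
def HexTight : Prop :=
  ∀ (D : Literature.Probability.RandomPlanarGeometry.DobrushinDomain) (a b : ℝ → Literature.Probability.LatticeModels.HexVertex), Literature.Probability.RandomPlanarGeometry.SAW.IsEmbEndpointApprox Literature.Probability.LatticeModels.hexGraph Literature.Probability.LatticeModels.hexCenter D a b → Literature.Probability.RandomPlanarGeometry.IsTightAlongMesh (fun δ (γ : Literature.Probability.RandomPlanarGeometry.SAW.HexDomainSAW D.carrier δ (a δ) (b δ)) => γ.curve) (fun δ => Literature.Probability.RandomPlanarGeometry.SAW.hexSAWLaw D.carrier δ (a δ) (b δ))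

/-- item stmt-CriticalPhenomena-14005 · crux · rank 6 · open · by planner
why it might fail: the martingale needs the observable limit in the SAW's own slit domains (rough tip), Carathéodory-uniformly, while HexObservableLimitR is per fixed flat-pinned Jordan domain; the b-normalisation is load-bearing for the drift.
sources: KemppainenSmirnov2017, DuminilCopinSmirnov2012, LawlerSchrammWerner2004SAW
[crux] the martingale-observable identification for the hexagonal SAW over the repaired target:
HexObservableLimitR → HexTight → (Duminil-Copin–Smirnov 2012 Conjecture 1 written out: for every
Dobrushin domain and hexagonal endpoint approximation the critical hexagonal SAW law hexSAWLaw,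
pushed to CurveClass ℂ, converges in law to chordal SLE(8/3) — verbatim the definiens of Literature
HexSAWScalingLimit and of the shared item HexConjecture, stmt-CriticalPhenomena-0808); re-targeting
for this route of the shared ObservableToSLE (stmt-CriticalPhenomena-10472), which became vacuous
when its antecedent HexObservableLimit was refuted. Intended proof unchanged: the b-normalised
observable ⟨ψ, F_(Ω∖γ[0,n])⟩/F_(Ω∖γ[0,n])(b) is an exact discrete martingale (domain Markov property
of the SAW), its limit c⟨ψ,(φ_n'/φ_n'(b))^(5/8)⟩ forces the driving process of every subsequential
limit to be √(8/3)B (LSW03 Prop. 5.2 / Itô on g_t'^(5/8)(g_t − W_t)^(−5/4)), and tightness +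
uniqueness of the SLE law conclude (SLEConvergenceCriterion). Now explicit as the FIRST step:
bootstrap Conj. 2 from the flat-pinned family of HexObservableLimitR (a, b on horizontal
half-lattice pieces) to Carathéodory-conve -/
@[route_item "route-CriticalPhenomena-SAWQuarterTwist", crux]
def ObservableToSLER : Prop :=
  HexObservableLimitR → HexTight → ∀ (D : Literature.Probability.RandomPlanarGeometry.DobrushinDomain) (a b : ℝ → Literature.Probability.LatticeModels.HexVertex), Literature.Probability.RandomPlanarGeometry.SAW.IsEmbEndpointApprox Literature.Probability.LatticeModels.hexGraph Literature.Probability.LatticeModels.hexCenter D a b → Literature.Probability.RandomPlanarGeometry.ConvergesInLawToSLE ((8 : NNReal) / 3) D (fun δ (γ : Literature.Probability.RandomPlanarGeometry.SAW.HexDomainSAW D.carrier δ (a δ) (b δ)) => γ.curve) (fun δ => Literature.Probability.RandomPlanarGeometry.SAW.hexSAWLaw D.carrier δ (a δ) (b δ))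

/-- item stmt-CriticalPhenomena-14221 · crux · rank 7 · open · by planner
why it might fail: the uniform ℤ² SAW lies in no Yang–Baxter family (barrier NienhuisWeightsExcludeVertexSAW), so no transfer tool exists even given the hexagonal limit; Kennedy–Lawler boundary effects could split ℤ² endpoint classes.
sources: GlazmanManolescu2019, KennedyLawler2013, Literature.Barriers.CriticalPhenomena.NienhuisWeightsExcludeVertexSAW
[crux] LATTICE-UNIVERSALITY TRANSFER (conjecture-grade: filed with kind support at rev 7 only
because the at-edit cap check counted 8 with it declared crux; the gate auto-promotes
conjecture-grade items to crux, intended rank 7 — a retriage follows if needed; rev 7 route choice;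
replaces in THIS route the shared tail HexConjecture stmt-0808 → HexToSquare stmt-10473 +
LatticeUniversality stmt-0807, which stays with the sibling routes SAWDefectDecoherence /
SAWResidueField / SAWWindingAlias / SAWDevelopingMap): Duminil-Copin–Smirnov 2012 Conjecture 1 —
written out verbatim as the conclusion of ObservableToSLER (for every Dobrushin domain and hexagonal
endpoint approximation IsEmbEndpointApprox the critical hexagonal SAW law hexSAWLaw, pushed to
CurveClass ℂ, converges in law to chordal SLE(8/3)) — IMPLIES the δℤ² sub-problem statement
SAWScalingLimit. Universality of the critical SAW scaling limit in exactly the implicational form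
the assembly needs: weaker than the asymptotic equality of laws LatticeUniversality (it may use
existence and conformal invariance of the hexagonal limit), Iff.rfl-equivalent to HexConjecture →
SAWScalingLimit, implied by HexToSquare ∧ LatticeUniversality ( -/
@[route_item "route-CriticalPhenomena-SAWQuarterTwist", crux]
def HexTransfer : Prop :=
  (∀ (D : Literature.Probability.RandomPlanarGeometry.DobrushinDomain) (a b : ℝ → Literature.Probability.LatticeModels.HexVertex), Literature.Probability.RandomPlanarGeometry.SAW.IsEmbEndpointApprox Literature.Probability.LatticeModels.hexGraph Literature.Probability.LatticeModels.hexCenter D a b → Literature.Probability.RandomPlanarGeometry.ConvergesInLawToSLE ((8 : NNReal) / 3) D (fun δ (γ : Literature.Probability.RandomPlanarGeometry.SAW.HexDomainSAW D.carrier δ (a δ) (b δ)) => γ.curve) (fun δ => Literature.Probability.RandomPlanarGeometry.SAW.hexSAWLaw D.carrier δ (a δ) (b δ))) → SAWScalingLimit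

/-- item stmt-CriticalPhenomena-16653 · support · rank 9 · open · by planner
sources: DuminilCopinSmirnov2012, Literature.Probability.RandomPlanarGeometry.SAW.DuminilCopinSmirnov2012_lemma1
[support] the quarter-twist vertex relation (exact, finite, NEW): on every simply connected
hexagonal domain Λ and every cell x₀, the observable Σ_γ x_c^ℓ e^(−i(5/8)W(γ)) i^(N(γ)) with source
the left vertical side of the hexagon at x₀ and N the signed number of traversals of the vertical
edges crossed by the horizontal ray from triEmbed x₀ to the right (up = +1) satisfies
(p−v)F(p)+(q−v)F(q)+(r−v)F(r) = 0 at every v ∈ Λ that is not an endpoint of the source edge or of a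
cut edge. Proof = DCS grouping + loop-orientation bookkeeping (pairs: hol ratio = hol(C)², turning
off by 8π iff x₀ inside C); verified by enumeration (folder exp/canonical.py, spinor.py, gauge.py).
[difficulty: M] -/
@[route_item "route-CriticalPhenomena-SAWQuarterTwist"]
def QuarterTwistRelation : Prop :=
  ∀ (Λ : Finset Literature.Probability.LatticeModels.HexVertex), Literature.Probability.RandomPlanarGeometry.SAW.hexDomainSimplyConnected Λ → ∀ (x₀ : Literature.Probability.LatticeModels.Site 2), let a : Sym2 Literature.Probability.LatticeModels.HexVertex := s((x₀ - Pi.single 0 1, (0 : Fin 2)), (x₀ - Pi.single 0 1 - Pi.single 1 1, (1 : Fin 2))); let sgn : Literature.Probability.LatticeModels.HexVertex → Literature.Probability.LatticeModels.HexVertex → ℤ := fun p q => if q.2 = 0 ∧ p.2 = 1 ∧ p.1 = q.1 - Pi.single 1 1 ∧ q.1 1 = x₀ 1 ∧ x₀ 0 ≤ q.1 0 then 1 else if p.2 = 0 ∧ q.2 = 1 ∧ q.1 = p.1 - Pi.single 1 1 ∧ p.1 1 = x₀ 1 ∧ x₀ 0 ≤ p.1 0 then -1 else 0; let F : Sym2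 Literature.Probability.LatticeModels.HexVertex → ℂ := fun z => ∑ γ : Literature.Probability.RandomPlanarGeometry.SAW.HexMidEdgeSAW Λ a z, γ.weight Literature.Probability.RandomPlanarGeometry.SAW.hexCriticalFugacity (5 / 8) * Complex.I ^ ((γ.verts.zip γ.verts.tail).map (fun pq => sgn pq.1 pq.2)).sum; ∀ v ∈ Λ, ¬ ((v.2 = 0 ∧ v.1 1 = x₀ 1 ∧ x₀ 0 - 1 ≤ v.1 0) ∨ (v.2 = 1 ∧ v.1 1 = x₀ 1 - 1 ∧ x₀ 0 - 1 ≤ v.1 0)) → ∀ p q r : Literature.Probability.LatticeModels.HexVertex, Literature.Probability.LatticeModels.hexGraph.Adj v p → Literature.Probability.LatticeModels.hexGraph.Adj v q → Literature.Probability.LatticeModels.hexGraph.Adj v r → p ≠ q → q ≠ r → p ≠ r → (Literature.Probability.RandomPlanarGeometry.SAW.hexMidpoint s(v, p) - Literature.Probability.LatticeModels.hexCenter v) * F s(v, p) + (Literature.Probability.RandomPlanarGeometry.SAW.hexMidpoint s(v, q) - Literature.Probability.LatticeModels.hexCenter v) * F s(v, q) + (Literature.Probability.RandomPlanarGeometry.SAW.hexMidpoint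 s(v, r) - Literature.Probability.LatticeModels.hexCenter v) * F s(v, r) = 0

/-- item stmt-CriticalPhenomena-16654 · assembly · rank 1 · open · by planner
sources: DuminilCopinSmirnov2012, KemppainenSmirnov2017
[assembly] the non-glue FRAME (as in SAWDefectDecoherence rev 20): the two bulk estimates, tightness
and the transfer suffice — TwistedPropagatorLaw → BulkScalingLimitExists → HexTight → HexTransfer →
SAWScalingLimit; proved exactly when the two implication cruxes BulkToBoundary and ObservableToSLER
land (`fun h1 h2 hT hTr => hTr (hO (h3 h1 h2) hT)`), not by any ground battery, and NOT a hypothesis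
of `closes`. -/
@[route_item "route-CriticalPhenomena-SAWQuarterTwist"]
def Assembly : Prop :=
  TwistedPropagatorLaw → BulkScalingLimitExists → HexTight → HexTransfer → _root_.SAWScalingLimit

/-! D-0027 §2.1 — DECIDING THEOREM (planner-authored via `route open/edit --closes-file`; by planner-plan-novel-CriticalPhenomena-SAWScaling-8a38611a-v2- 2026-08-16T20:27:52Z):
its hypotheses are this route's items and its conclusion the sub-problem Statement (glue_lint), and it elaborates with this file. -/

@[closes "route-CriticalPhenomena-SAWQuarterTwist"] theorem closes (h1 : TwistedPropagatorLaw) (h2 : BulkScalingLimitExists) (h3 : BulkToBoundary)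
    (hT : HexTight) (hO : ObservableToSLER) (hTr : HexTransfer) : _root_.SAWScalingLimit :=
  hTr (hO (h3 h1 h2) hT)

end Summit.CriticalPhenomena.SAWScalingLimit.Theses.SAWQuarterTwist
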